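import Mathlib
import Summits.ResolutionOfSingularities.ResolutionOfSingularities.Theorems.WildQuotientsWildQuotientResolutionLinearCharThreeOfV3
import Summits.ResolutionOfSingularities.ResolutionOfSingularities.Theorems.WildQuotientsWildQuotientResolutionJordanThreeK3Model

/-!
# PRIZE: every LINEAR `ℤ/3`-quotient `𝔸ⁿ/σ`, `n ≤ 4`, in characteristic `3` has a resolution of singularities

(crux stmt-ResolutionOfSingularities-15640 `WildQuotients.WildQuotientResolution`, line `Sketch`,
sector `|G| = p`; registered stub `linearCyclicQuotient_hasResolution_charThree` = PRIZE of
`L/w45c/W45cPlanSignaturesV4.lean` §D VERBATIM. [OURS · L1 W4.5c] — NOT a statement of any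
manuscript; replaces the role of no printed item. Prover res-L1-w45c-stub-4.)

With SQZ-4 (`LinearSqZero.linearInvolution_hasResolution_charTwo`, p478142: all linear involutions,
`p = 2`, all `n`) this closes the LINEAR sector of `CyclicQuotientFourfolds` (stmt-17941) for
`p ≤ 3`, unconditionally: `σ³ = 1` on the coordinates of `𝔸ⁿ`, `n ≤ 4`, `char k = 3` ⟹ `(σ − 1)³ = 0`
⟹ (JNF-3, p479366) `σ` is conjugate to a linear-small-blocks datum — Jordan types `2+2` (T p470649),
`2+1+1`, `1⁴` (LSB p471938) — or to `J₃` with passengers — rung V3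
(`JordanThree.v3_hasResolution_charThree`, p486000: ONE blow-up of the `σ`-stable complete monomial
ideal `K₃ = (x_a⁴, x_a³x_b, x_a²x_b³, x_a x_b⁴, x_b⁶)`, Király–Lütkebohmert terminal, Bl regular by
four polynomial charts) —, transported back by conjugation (p471072). The composition modulo V3 is
`LinearCubeZero.linearCyclicQuotient_hasResolution_charThree_of_v3` (p480877).
-/

-- single-problem summit: the doubled namespace component `ResolutionOfSingularities` is forced
set_option linter.dupNamespace false

noncomputable section

open Module MvPolynomial AlgebraicGeometry CategoryTheory Literature.AlgebraicGeometry.Resolution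

namespace Summit.ResolutionOfSingularities.ResolutionOfSingularities.Theorems.WildQuotientResolution.LinearCubeZero

/-- **PRIZE `linearCyclicQuotient_hasResolution_charThree`** (`W45cPlanSignaturesV4.lean` §D,
verbatim; registered stub): every LINEAR `ℤ/3`-quotient `𝔸ⁿ/σ`, `n ≤ 4`, `char k = 3` (`σ³ = 1` on the
coordinates), has a resolution of singularities — the `p = 3` half of the LINEAR sector of
`CyclicQuotientFourfolds` (stmt-17941); `p = 2` is SQZ-4. Proof: `_of_v3` (p480877) fed with rung V3
(`JordanThree.v3_hasResolution_charThree`, p486000). [OURS · L1 W4.5c]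
[cite: KiralyLutkebohmert2013, Thm 2] -/
theorem linearCyclicQuotient_hasResolution_charThree (k : Type) [Field k] [CharP k 3] (n : ℕ)
    (hn : n ≤ 4) (σ : MvPolynomial (Fin n) k ≃ₐ[k] MvPolynomial (Fin n) k)
    (hlin : ∀ i, σ (X i) ∈ Submodule.span k (Set.range (X : Fin n → MvPolynomial (Fin n) k)))
    (hord : ∀ i, σ (σ (σ (X i))) = X i) :
    Scheme.HasResolution
      (Spec (.of (FixedPoints.subalgebra k (MvPolynomial (Fin n) k) (Subgroup.zpowers σ)))) :=
  linearCyclicQuotient_hasResolution_charThree_of_v3 k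
    (fun n σ a b c => JordanThree.v3_hasResolution_charThree k n σ a b c) n hn σ hlin hord

/-- Sanity instance (kernel-checked): the fourfold quotient `𝔸⁴/σ` for ANY linear `σ` of order
dividing `3` in characteristic `3` — e.g. `V₃ ⊕ V₁`, `V₂ ⊕ V₂`, `V₂ ⊕ V₁ ⊕ V₁`, in any linear disguise —
has a resolution. [OURS · L1 W4.5c] -/
example (k : Type) [Field k] [CharP k 3]
    (σ : MvPolynomial (Fin 4) k ≃ₐ[k] MvPolynomial (Fin 4) k)
    (hlin : ∀ i, σ (X i) ∈ Submodule.span k (Set.range (X : Fin 4 → MvPolynomial (Fin 4) k)))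
    (hord : ∀ i, σ (σ (σ (X i))) = X i) :
    Scheme.HasResolution
      (Spec (.of (FixedPoints.subalgebra k (MvPolynomial (Fin 4) k) (Subgroup.zpowers σ)))) :=
  linearCyclicQuotient_hasResolution_charThree k 4 le_rfl σ hlin hord

end Summit.ResolutionOfSingularities.ResolutionOfSingularities.Theorems.WildQuotientResolution.LinearCubeZero

end
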